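import Mathlib
import HarnessLib
import Summits.NavierStokesRegularity.NavierStokesRegularity.Theorems.TaylorModelRungThreeSoundnessVectorPair

/-!
# Line `taylor-model` on crux K1b-DR (`ExactWindowRungThree.DerivativeEnclosureCertificateR`,
# stmt-NavierStokesRegularity-23954) — VECTOR STEP LEMMA, part 5: the HIGH-ORDER rough-enclosure test
# (memo §1 "optional v3.1", Nedialkov–Jackson style)

Why this part exists: the first-order test of part 1 (`x₀ + u • Q y y ∈ B`) carries the explicit-Euler step
restriction `h · λ_max ≲ 1` on the stiff (fast, empty) window shells — the same restriction that sank the scalar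
majorant — whereas the order-`p` test below admits `h · λ_max` of the size of the stability radius of the order-`p`
Taylor method.  Setting of parts 1–4 (finite `ι`, bundled bilinear `Q`, abstract jets `T` with the S1 recursion).

* `exists_clamped_sol` — the box-clamped field has a solution on every `[0,h]` from every point (Picard–Lindelöf,
  globally Lipschitz field; the engine of part 1 exported);
* `exists_sol_mem_Icc_of_highOrderEnclosure` — **HIGH-ORDER ENCLOSURE TEST ⇒ EXISTENCE + CONFINEMENT**: if
  `|T y (p+1) c| ≤ J c` on the box `[lo,hi]` and, for every `u ∈ [0,h]` and every coordinate, STRICTLY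
  `lo c < Σ_{k≤p} T x₀ k c u^k − J c u^(p+1)` and `Σ_{k≤p} T x₀ k c u^k + J c u^(p+1) < hi c`, then the solution from
  `x₀` exists on `[0,h]` and stays in `[lo,hi]`.  Proof: continuous induction on `[0,h]`
  (`IsClosed.Icc_subset_of_forall_mem_nhdsGT_of_Icc_subset`) for the CLAMPED trajectory: while it is in the box it
  is a true solution, the componentwise Lagrange remainder of part 2 puts it in the OPEN box, continuity keeps it in
  the box a little longer; the set of good times is closed.  (Strictness is used exactly once, at the exit time.)
* `exists_blockJets` — the block system of part 3 with its jets `(T,U)` packaged (field equation, `T₂ z 0 = z`,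
  recursion), so that the high-order test applies verbatim to the PAIR (trajectory, variation): corollary
  `exists_pair_sol_mem_Icc_of_highOrderEnclosure`;
* `flowSel_of_highOrderEnclosure` — `Fin n` / S1-vocabulary corollary: the global selector solves on `[0,h]`, is
  confined, and obeys the componentwise Taylor remainder, under the high-order test (no `b·m·h < 1`).

MODEL-lattice bookkeeping only (rung TL-M3 of the NS ladder: one finite-dimensional model ODE); nothing
here is a statement about the Navier–Stokes equations.
-/

noncomputable section

-- the sub-problem namespace repeats the summit name by design (D-0017)
set_option linter.dupNamespace false

namespace Summit.NavierStokesRegularity.NavierStokesRegularity.Theorems.TaylorModelVector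

open scoped BigOperators Topology NNReal
open Set Filter Metric

section General

variable {ι : Type*} [Fintype ι] [DecidableEq ι]
  (Q : (ι → ℝ) →ₗ[ℝ] (ι → ℝ) →ₗ[ℝ] ι → ℝ) {T : (ι → ℝ) → ℕ → ι → ℝ}
  {U : (ι → ℝ) → (ι → ℝ) → ℕ → ι → ℝ}

/-- **The clamped field has global solutions**: for `lo ≤ hi`, `0 ≤ h` and ANY `x₀`, the field
`y ↦ Q (π y) (π y)` (`π` the coordinatewise clamp onto `[lo,hi]`) has a solution on `[0,h]` from `x₀`
(Picard–Lindelöf for a globally Lipschitz bounded field). [folklore] -/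
theorem exists_clamped_sol {lo hi : ι → ℝ} (hlh : lo ≤ hi) (x₀ : ι → ℝ) {h : ℝ} (hh : 0 ≤ h) :
    ∃ α : ℝ → ι → ℝ, α 0 = x₀ ∧ ∀ s ∈ Icc 0 h, HasDerivWithinAt α
      (Q (fun c => max (lo c) (min (α s c) (hi c))) (fun c => max (lo c) (min (α s c) (hi c)))) (Icc 0 h) s := by
  set π : (ι → ℝ) → (ι → ℝ) := fun y c => max (lo c) (min (y c) (hi c)) with hπ
  have hπmem : ∀ y, π y ∈ Icc lo hi := fun y => clamp_mem hlh y
  obtain ⟨C, hC0, hC⟩ := exists_norm_Q_le Q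
  set R : ℝ := max ‖lo‖ ‖hi‖ with hRdef
  have hR0 : 0 ≤ R := le_max_of_le_left (norm_nonneg _)
  have hπR : ∀ y, ‖π y‖ ≤ R := fun y => norm_le_of_mem_Icc (hπmem y)
  set F : (ι → ℝ) → (ι → ℝ) := fun y => Q (π y) (π y) with hF
  have hFlip : LipschitzWith (Real.toNNReal (2 * C * R)) F := by
    refine LipschitzWith.of_dist_le_mul fun y z => ?_
    rw [Real.coe_toNNReal _ (by positivity), dist_eq_norm]
    have e : F y - F z = Q (π y - π z) (π y) + Q (π z) (π y - π z) := by
      simp only [hF]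
      rw [map_sub, LinearMap.sub_apply, map_sub]
      abel
    have hd : ‖π y - π z‖ ≤ dist y z := by rw [← dist_eq_norm]; exact dist_clamp_le lo hi y z
    rw [e]
    calc ‖Q (π y - π z) (π y) + Q (π z) (π y - π z)‖
        ≤ ‖Q (π y - π z) (π y)‖ + ‖Q (π z) (π y - π z)‖ := norm_add_le _ _
      _ ≤ C * ‖π y - π z‖ * ‖π y‖ + C * ‖π z‖ * ‖π y - π z‖ := add_le_add (hC _ _) (hC _ _)
      _ ≤ C * dist y z * R + C * R * dist y z := by gcongr <;> exact hπR _
      _ = 2 * C * R * dist y z := by ring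
  have hFbd : ∀ y, ‖F y‖ ≤ C * R * R := fun y =>
    calc ‖F y‖ = ‖Q (π y) (π y)‖ := rfl
      _ ≤ C * ‖π y‖ * ‖π y‖ := hC _ _
      _ ≤ C * R * R := by gcongr <;> exact hπR y
  set L : ℝ≥0 := ⟨C * R * R, by positivity⟩ with hL
  set hN : ℝ≥0 := ⟨h, hh⟩ with hhN
  have t₀mem : (0:ℝ) ∈ Icc (0:ℝ) h := ⟨le_rfl, hh⟩
  have hPL : IsPicardLindelof (fun (_ : ℝ) (y : ι → ℝ) => F y) (⟨0, t₀mem⟩ : Icc (0:ℝ) h) x₀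
      (L * hN) 0 L (Real.toNNReal (2 * C * R)) :=
    { lipschitzOnWith := fun _ _ => hFlip.lipschitzOnWith
      continuousOn := fun _ _ => continuousOn_const
      norm_le := fun _ _ y _ => hFbd y
      mul_max_le := by
        simp only [sub_zero, sub_self, max_eq_left hh, NNReal.coe_mul, NNReal.coe_zero, hL, hhN]
        exact le_rfl }
  obtain ⟨α, hα0, hα⟩ := hPL.exists_eq_forall_mem_Icc_hasDerivWithinAt₀
  exact ⟨α, hα0, hα⟩

/-- **HIGH-ORDER ROUGH-ENCLOSURE TEST ⇒ EXISTENCE + CONFINEMENT.** If the order-`p+1` jet is enclosed on the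
box, `|T y (p+1) c| ≤ J c` for `y ∈ [lo,hi]`, and for all `u ∈ [0,h]` and all coordinates, STRICTLY,
`lo c < Σ_{k≤p} T x₀ k c u^k − J c u^(p+1)` and `Σ_{k≤p} T x₀ k c u^k + J c u^(p+1) < hi c`, then the solution of
`ψ' = Q(ψ,ψ)`, `ψ 0 = x₀` exists on `[0,h]` and stays in `[lo,hi]` (Lohner 1988 / Nedialkov–Jackson–Corliss 1999,
high-order enclosure; continuous induction for the clamped trajectory). [folklore] -/
theorem exists_sol_mem_Icc_of_highOrderEnclosure (hT0 : ∀ x, T x 0 = x)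
    (hTs : ∀ x (k : ℕ) c, ((k : ℝ) + 1) * T x (k + 1) c =
      ∑ i ∈ Finset.range (k + 1), Q (T x i) (T x (k - i)) c)
    {lo hi x₀ : ι → ℝ} {h : ℝ} (hh : 0 ≤ h) {p : ℕ} {J : ι → ℝ}
    (hJ : ∀ y ∈ Icc lo hi, ∀ c, |T y (p + 1) c| ≤ J c)
    (htest : ∀ u ∈ Icc (0:ℝ) h, ∀ c,
      lo c < ∑ k ∈ Finset.range (p + 1), T x₀ k c * u ^ k - J c * u ^ (p + 1) ∧
      ∑ k ∈ Finset.range (p + 1), T x₀ k c * u ^ k + J c * u ^ (p + 1) < hi c) :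
    ∃ ψ : ℝ → ι → ℝ, ψ 0 = x₀ ∧ (∀ s ∈ Icc 0 h, HasDerivWithinAt ψ (Q (ψ s) (ψ s)) (Icc 0 h) s) ∧
      ∀ s ∈ Icc 0 h, ψ s ∈ Icc lo hi := by
  -- the test at `u = 0`: `x₀` is in the OPEN box
  have hsum0 : ∀ c, ∑ k ∈ Finset.range (p + 1), T x₀ k c * (0:ℝ) ^ k = x₀ c := by
    intro c
    rw [Finset.sum_eq_single 0 (fun k _ hk => by rw [zero_pow hk, mul_zero])
      (fun h0 => absurd (Finset.mem_range.2 (Nat.succ_pos p)) h0), pow_zero, mul_one, hT0]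
  have hx₀' : ∀ c, lo c < x₀ c ∧ x₀ c < hi c := by
    intro c
    have h1 := htest 0 ⟨le_rfl, hh⟩ c
    rw [hsum0 c, zero_pow (Nat.succ_ne_zero p), mul_zero, sub_zero, add_zero] at h1
    exact h1
  have hx₀ : x₀ ∈ Icc lo hi := ⟨fun c => (hx₀' c).1.le, fun c => (hx₀' c).2.le⟩
  have hlh : lo ≤ hi := hx₀.1.trans hx₀.2
  -- the clamped trajectory
  set π : (ι → ℝ) → (ι → ℝ) := fun y c => max (lo c) (min (y c) (hi c)) with hπ
  have hπeq : ∀ y ∈ Icc lo hi, π y = y := fun y hy => clamp_eq_self hy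
  obtain ⟨α, hα0, hα⟩ := exists_clamped_sol Q hlh x₀ hh
  have hαc : ContinuousOn α (Icc 0 h) := fun s hs => (hα s hs).continuousWithinAt
  -- continuous induction: the set of times at which the clamped trajectory is in the box
  set S : Set ℝ := {σ | α σ ∈ Icc lo hi} with hS
  have hSclosed : IsClosed (S ∩ Icc 0 h) := by
    rw [inter_comm]
    exact hαc.preimage_isClosed_of_isClosed isClosed_Icc isClosed_Icc
  have h0S : (0:ℝ) ∈ S := by
    show α 0 ∈ Icc lo hi
    rw [hα0]
    exact hx₀
  have key : Icc 0 h ⊆ S := by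
    refine hSclosed.Icc_subset_of_forall_mem_nhdsGT_of_Icc_subset h0S fun t ht hpast => ?_
    -- on `[0,t]` the clamped trajectory is a true solution confined to the box
    have hsub : Icc 0 t ⊆ Icc 0 h := Icc_subset_Icc_right ht.2.le
    have hbox : ∀ σ ∈ Icc 0 t, α σ ∈ Icc lo hi := fun σ hσ => hpast hσ
    have hsol : ∀ σ ∈ Icc 0 t, HasDerivWithinAt α (Q (α σ) (α σ)) (Icc 0 t) σ := by
      intro σ hσ
      have h1 := (hα σ (hsub hσ)).mono hsub
      have e : π (α σ) = α σ := hπeq _ (hbox σ hσ)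
      simp only [hπ] at e
      rw [e] at h1
      exact h1
    have hrem := abs_sub_taylor_le_of_mem_Icc Q hT0 hTs hsol hbox hJ t ⟨ht.1, le_rfl⟩
    rw [hα0] at hrem
    -- hence `α t` is in the OPEN box
    have hopen : ∀ c, lo c < α t c ∧ α t c < hi c := by
      intro c
      have h1 := abs_le.1 (hrem c)
      have h2 := htest t ⟨ht.1, ht.2.le⟩ c
      constructor <;> linarith [h1.1, h1.2, h2.1, h2.2]
    set O : Set (ι → ℝ) := Set.pi univ fun c => Ioo (lo c) (hi c) with hO
    have hOopen : IsOpen O := isOpen_set_pi finite_univ fun c _ => isOpen_Ioo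
    have hαtO : α t ∈ O := mem_univ_pi.2 fun c => hopen c
    have hOS : α ⁻¹' O ⊆ S := fun σ hσ =>
      ⟨fun c => ((mem_univ_pi.1 hσ) c).1.le, fun c => ((mem_univ_pi.1 hσ) c).2.le⟩
    have hmem : S ∈ 𝓝[Icc 0 h] t :=
      mem_of_superset ((hαc t (hsub ⟨ht.1, le_rfl⟩)).preimage_mem_nhdsWithin (hOopen.mem_nhds hαtO))
        hOS
    have hIoo : Ioo t h ⊆ Icc 0 h := fun σ hσ => ⟨ht.1.trans hσ.1.le, hσ.2.le⟩
    have hmem' : S ∈ 𝓝[Ioo t h] t := nhdsWithin_mono t hIoo hmem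
    rwa [nhdsWithin_Ioo_eq_nhdsGT ht.2] at hmem'
  -- the confined clamped trajectory solves the unclamped equation
  refine ⟨α, hα0, fun s hs => ?_, fun s hs => key hs⟩
  have h1 := hα s hs
  have e : π (α s) = α s := hπeq _ (key hs)
  simp only [hπ] at e
  rw [e] at h1
  exact h1

omit [Fintype ι] [DecidableEq ι] in
/-- **The block system with its jets**, packaged: the bilinear field `(y,v) ↦ (Q(y,y'), Q(y,v')+Q(v,y'))` on
`ι ⊕ ι → ℝ` and the jets `(T, U)` satisfy the same recursion (part 3's identification, exported). [folklore] -/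
theorem exists_blockJets (hT0 : ∀ x, T x 0 = x)
    (hTs : ∀ x (k : ℕ) c, ((k : ℝ) + 1) * T x (k + 1) c =
      ∑ i ∈ Finset.range (k + 1), Q (T x i) (T x (k - i)) c)
    (hU0 : ∀ x v, U x v 0 = v)
    (hUs : ∀ x v (k : ℕ) c, ((k : ℝ) + 1) * U x v (k + 1) c =
      ∑ i ∈ Finset.range (k + 1), (Q (T x i) (U x v (k - i)) c + Q (U x v (k - i)) (T x i) c)) :
    ∃ (Q₂ : (ι ⊕ ι → ℝ) →ₗ[ℝ] (ι ⊕ ι → ℝ) →ₗ[ℝ] (ι ⊕ ι → ℝ)) (T₂ : (ι ⊕ ι → ℝ) → ℕ → ι ⊕ ι → ℝ),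
      (∀ z z' : ι ⊕ ι → ℝ, Q₂ z z' = Sum.elim (Q (z ∘ Sum.inl) (z' ∘ Sum.inl))
        (Q (z ∘ Sum.inl) (z' ∘ Sum.inr) + Q (z ∘ Sum.inr) (z' ∘ Sum.inl))) ∧
      (∀ z k, T₂ z k = Sum.elim (T (z ∘ Sum.inl) k) (U (z ∘ Sum.inl) (z ∘ Sum.inr) k)) ∧
      (∀ z, T₂ z 0 = z) ∧
      (∀ z (k : ℕ) c₂, ((k : ℝ) + 1) * T₂ z (k + 1) c₂ =
        ∑ i ∈ Finset.range (k + 1), Q₂ (T₂ z i) (T₂ z (k - i)) c₂) := by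
  obtain ⟨Q₂, hQ₂⟩ := exists_blockField Q
  obtain ⟨T₂, hT₂⟩ : ∃ T₂ : (ι ⊕ ι → ℝ) → ℕ → ι ⊕ ι → ℝ,
      T₂ = fun z k => Sum.elim (T (z ∘ Sum.inl) k) (U (z ∘ Sum.inl) (z ∘ Sum.inr) k) := ⟨_, rfl⟩
  refine ⟨Q₂, T₂, hQ₂, fun z k => by rw [hT₂], fun z => ?_, fun z k c₂ => ?_⟩
  · simp only [hT₂, hT0, hU0, Sum.elim_comp_inl_inr]
  · simp only [hT₂, hQ₂, Sum.elim_comp_inl, Sum.elim_comp_inr]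
    rcases c₂ with c | c
    · simp only [Sum.elim_inl]
      exact hTs _ k c
    · simp only [Sum.elim_inr, Pi.add_apply]
      rw [hUs, Finset.sum_add_distrib, Finset.sum_add_distrib]
      congr 1
      rw [← Finset.sum_range_reflect (fun i =>
        Q (U (z ∘ Sum.inl) (z ∘ Sum.inr) i) (T (z ∘ Sum.inl) (k - i)) c) (k + 1)]
      refine Finset.sum_congr rfl fun i hi => ?_
      have hik : i ≤ k := Nat.lt_succ_iff.mp (Finset.mem_range.mp hi)
      simp only [show k + 1 - 1 - i = k - i by omega, show k - (k - i) = i by omega]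

/-- **High-order test for the PAIR (trajectory, variation)**: with jet enclosures `|T y (p+1) c| ≤ J c` and
`|U y v (p+1) c| ≤ JV c` over `[lo,hi] × [loV,hiV]`, and the strict order-`p` tests for `x₀` (jets `T x₀ k`) and
for `v₀` (jets `U x₀ v₀ k`), the solution `ψ` from `x₀` and the variation `V` (`V' = Q(ψ,V)+Q(V,ψ)`, `V 0 = v₀`)
exist on `[0,h]` and stay in their boxes. [folklore] -/
theorem exists_pair_sol_mem_Icc_of_highOrderEnclosure (hT0 : ∀ x, T x 0 = x)
    (hTs : ∀ x (k : ℕ) c, ((k : ℝ) + 1) * T x (k + 1) c =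
      ∑ i ∈ Finset.range (k + 1), Q (T x i) (T x (k - i)) c)
    (hU0 : ∀ x v, U x v 0 = v)
    (hUs : ∀ x v (k : ℕ) c, ((k : ℝ) + 1) * U x v (k + 1) c =
      ∑ i ∈ Finset.range (k + 1), (Q (T x i) (U x v (k - i)) c + Q (U x v (k - i)) (T x i) c))
    {lo hi x₀ loV hiV v₀ : ι → ℝ} {h : ℝ} (hh : 0 ≤ h) {p : ℕ} {J JV : ι → ℝ}
    (hJ : ∀ y ∈ Icc lo hi, ∀ c, |T y (p + 1) c| ≤ J c)
    (hJV : ∀ y ∈ Icc lo hi, ∀ v ∈ Icc loV hiV, ∀ c, |U y v (p + 1) c| ≤ JV c)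
    (htest : ∀ u ∈ Icc (0:ℝ) h, ∀ c,
      lo c < ∑ k ∈ Finset.range (p + 1), T x₀ k c * u ^ k - J c * u ^ (p + 1) ∧
      ∑ k ∈ Finset.range (p + 1), T x₀ k c * u ^ k + J c * u ^ (p + 1) < hi c)
    (htestV : ∀ u ∈ Icc (0:ℝ) h, ∀ c,
      loV c < ∑ k ∈ Finset.range (p + 1), U x₀ v₀ k c * u ^ k - JV c * u ^ (p + 1) ∧
      ∑ k ∈ Finset.range (p + 1), U x₀ v₀ k c * u ^ k + JV c * u ^ (p + 1) < hiV c) :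
    ∃ ψ V : ℝ → ι → ℝ, ψ 0 = x₀ ∧ V 0 = v₀ ∧
      (∀ s ∈ Icc 0 h, HasDerivWithinAt ψ (Q (ψ s) (ψ s)) (Icc 0 h) s) ∧
      (∀ s ∈ Icc 0 h, HasDerivWithinAt V (Q (ψ s) (V s) + Q (V s) (ψ s)) (Icc 0 h) s) ∧
      (∀ s ∈ Icc 0 h, ψ s ∈ Icc lo hi) ∧ (∀ s ∈ Icc 0 h, V s ∈ Icc loV hiV) := by
  obtain ⟨Q₂, T₂, hQ₂, hT₂, hT0₂, hTs₂⟩ := exists_blockJets Q hT0 hTs hU0 hUs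
  have hJ₂ : ∀ y₂ ∈ Icc (Sum.elim lo loV) (Sum.elim hi hiV), ∀ c₂, |T₂ y₂ (p + 1) c₂| ≤ Sum.elim J JV c₂ := by
    intro y₂ hy₂ c₂
    have hy : y₂ ∘ Sum.inl ∈ Icc lo hi := ⟨fun c => hy₂.1 (Sum.inl c), fun c => hy₂.2 (Sum.inl c)⟩
    have hv : y₂ ∘ Sum.inr ∈ Icc loV hiV := ⟨fun c => hy₂.1 (Sum.inr c), fun c => hy₂.2 (Sum.inr c)⟩
    rw [hT₂]
    rcases c₂ with c | c
    · simpa using hJ _ hy c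
    · simpa using hJV _ hy _ hv c
  have htest₂ : ∀ u ∈ Icc (0:ℝ) h, ∀ c₂,
      Sum.elim lo loV c₂ < ∑ k ∈ Finset.range (p + 1), T₂ (Sum.elim x₀ v₀) k c₂ * u ^ k
          - Sum.elim J JV c₂ * u ^ (p + 1) ∧
      ∑ k ∈ Finset.range (p + 1), T₂ (Sum.elim x₀ v₀) k c₂ * u ^ k
          + Sum.elim J JV c₂ * u ^ (p + 1) < Sum.elim hi hiV c₂ := by
    intro u hu c₂
    simp only [hT₂, Sum.elim_comp_inl, Sum.elim_comp_inr]
    rcases c₂ with c | c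
    · simpa using htest u hu c
    · simpa using htestV u hu c
  obtain ⟨ψ₂, h0, hder, hbox⟩ := exists_sol_mem_Icc_of_highOrderEnclosure Q₂ hT0₂ hTs₂ hh hJ₂ htest₂
  refine ⟨fun s => ψ₂ s ∘ Sum.inl, fun s => ψ₂ s ∘ Sum.inr, ?_, ?_, ?_, ?_, ?_, ?_⟩
  · funext c; simp [h0]
  · funext c; simp [h0]
  · intro s hs
    refine hasDerivWithinAt_pi.2 fun c => ?_
    have h1 := (hasDerivWithinAt_pi.1 (hder s hs)) (Sum.inl c)
    rw [hQ₂] at h1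
    simpa using h1
  · intro s hs
    refine hasDerivWithinAt_pi.2 fun c => ?_
    have h1 := (hasDerivWithinAt_pi.1 (hder s hs)) (Sum.inr c)
    rw [hQ₂] at h1
    simpa using h1
  · exact fun s hs => ⟨fun c => (hbox s hs).1 (Sum.inl c), fun c => (hbox s hs).2 (Sum.inl c)⟩
  · exact fun s hs => ⟨fun c => (hbox s hs).1 (Sum.inr c), fun c => (hbox s hs).2 (Sum.inr c)⟩

end General

/-! ### `Fin n` corollary next to S1's vocabulary -/

section Majorant

open Summit.NavierStokesRegularity.NavierStokesRegularity.Theorems.TaylorModelMajorant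

variable {n : ℕ} {Q : (Fin n → ℝ) → (Fin n → ℝ) → Fin n → ℝ} {w : Fin n → ℝ} {b : ℝ}
  {T : (Fin n → ℝ) → ℕ → Fin n → ℝ} {U : (Fin n → ℝ) → (Fin n → ℝ) → ℕ → Fin n → ℝ}

/-- **High-order test ⇒ the global selector solves, is confined, and obeys the componentwise Taylor remainder**
on `[0,h]` (no `b·m·h < 1`). [folklore] -/
theorem flowSel_of_highOrderEnclosure (hS : IsMajorantSystem n Q w b T U) {lo hi x₀ : Fin n → ℝ}
    {h : ℝ} (hh : 0 ≤ h) {p : ℕ} {J : Fin n → ℝ} (hJ : ∀ y ∈ Icc lo hi, ∀ c, |T y (p + 1) c| ≤ J c)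
    (htest : ∀ u ∈ Icc (0:ℝ) h, ∀ c,
      lo c < ∑ k ∈ Finset.range (p + 1), T x₀ k c * u ^ k - J c * u ^ (p + 1) ∧
      ∑ k ∈ Finset.range (p + 1), T x₀ k c * u ^ k + J c * u ^ (p + 1) < hi c) :
    IsSolOn Q x₀ h (fun s => flowSel Q x₀ s) ∧ (∀ s ∈ Icc 0 h, flowSel Q x₀ s ∈ Icc lo hi) ∧
      ∀ s ∈ Icc 0 h, ∀ c,
        |flowSel Q x₀ s c - ∑ k ∈ Finset.range (p + 1), T x₀ k c * s ^ k| ≤ J c * s ^ (p + 1) := by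
  obtain ⟨Qb, hQb⟩ := exists_bundle hS
  have hTs : ∀ x (k : ℕ) c, ((k : ℝ) + 1) * T x (k + 1) c =
      ∑ i ∈ Finset.range (k + 1), Qb (T x i) (T x (k - i)) c := by
    simpa only [hQb] using hS.T_succ
  obtain ⟨ψ, h0, hder, hbox⟩ := exists_sol_mem_Icc_of_highOrderEnclosure Qb hS.T_zero hTs hh hJ htest
  have hsol : IsSolOn Q x₀ h ψ := ⟨h0, by simpa only [hQb] using hder⟩
  have heq : ∀ s ∈ Icc 0 h, flowSel Q x₀ s = ψ s := fun s hs => hS.flowSel_eq hsol hs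
  refine ⟨⟨flowSel_zero x₀, fun s hs => ?_⟩, fun s hs => (heq s hs).symm ▸ hbox s hs, fun s hs c => ?_⟩
  · show HasDerivWithinAt (fun s => flowSel Q x₀ s) (Q (flowSel Q x₀ s) (flowSel Q x₀ s)) (Icc 0 h) s
    rw [heq s hs]
    exact (hsol.2 s hs).congr (fun σ hσ => heq σ hσ) (heq s hs)
  · have key := abs_sub_taylor_le_of_mem_Icc Qb hS.T_zero hTs hder hbox hJ s hs c
    rwa [h0, ← heq s hs] at key

end Majorant

end Summit.NavierStokesRegularity.NavierStokesRegularity.Theorems.TaylorModelVector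

end
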